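import Literature.NumberTheory.Sieve.MoebiusShiftedPrimesMeanSquareTrunc
import Literature.NumberTheory.Sieve.MoebiusShiftedPrimesTypical
import Literature.NumberTheory.Sieve.MoebiusShiftedPrimesMajorArcs
import Literature.NumberTheory.Sieve.IntervalSieveBound
import HarnessLib

/-!
# Möbius on shifted primes — Proposition 3.4 of Lichtman 2020 from Proposition 5.1 and Lemma 4.8 (corrected chain)

Topic `Literature/NumberTheory/Sieve`, part of the decomposition of the named facts
`Literature.NumberTheory.Sieve.lichtman2020_moebius_shifted_primes_avg` /
`Literature.NumberTheory.Sieve.lichtman2020_moebius_shifted_primes_avg_power` (J. D. Lichtman,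
*Averages of the Möbius function on shifted primes*, Q. J. Math. (2021), doi:10.1093/qmath/haab054,
arXiv:2009.08969 [Lichtman2020], Theorem 1.1).  Page numbers refer to the held copy
`paper:arxiv-2009.08969`.

`MoebiusShiftedPrimesTypical.lean` records a gap in the printed proof of Proposition 5.1 at the
printed first exponent `P₁ = (log X)^{33A}` and re-targets the decomposition along the typical sets
`S_c = lichtmanTypicalWith c` with `c ≥ 100`, vendoring the corrected Proposition 5.1
(`Lichtman2020_dirichletMeanValueWith`), the corrected Proposition 3.4
(`Lichtman2020_liouvilleMeanSquareWith`) and Lemma 4.8 (`Lichtman2020_liouvilleCharacterSifted`) as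
named facts.  This file PROVES the printed implication between them — "Proof of Proposition 3.4
from Proposition 5.1" (p. 14) — for every `c ≥ 100`:

* `Lichtman2020_liouvilleMeanSquareWith_of_dirichletMeanValueWith :
    Lichtman2020_dirichletMeanValueWith → Lichtman2020_liouvilleCharacterSifted →
    Lichtman2020_liouvilleMeanSquareWith`.

The other printed inputs are proved in the tree: Lemma 4.6 (the Parseval bound,
`MoebiusShiftedPrimesParseval.lean`) and Lemma 4.1 (the mean value theorem,
`Literature.NumberTheory.LFunctions.dirichletPolynomial_meanSquare_le`); the analytic bookkeeping is
`Lichtman2020.meanSquare_le_of_pieces_trunc` (`MoebiusShiftedPrimesMeanSquareTrunc.lean`), which uses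
Proposition 5.1 at the single scale `Y ≤ X` recorded in `Lichtman2020_dirichletMeanValueWith` (the
Parseval polynomial lives on `[Y, 4Y]`; the coefficients beyond `2Y + h₂`, which no window sees, are
truncated and the short tail is handled by Lemma 4.1).

## The proof (p. 14, made effective), for `S = S_c`, `c ≥ 100`

Fix `A > 5`, `δ > 0`, `H` in the regime, `q ≤ W = (log X)^A`, `χ (mod q)`, `h ∈ [H/W⁵, H]`,
`Y ∈ [X/W⁶, X]`; write `S_ℓ(x) = ∑_{x ≤ m ≤ x+ℓ, m ∈ S} λ(m)χ(m)`, `ℓ = log X`, `T₀ = ℓ^{2B}`,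
`B = 11A`, `h₂ = Y/T₀³`, `K = 71A`.
* (5.3): `∑_{m ≤ x, m ∈ S} λχ(m) ≪ x (log x)^{-K}` by inclusion–exclusion over the two intervals
  `[P_j, Q_j]` (`𝟙_S = 1 - 𝟙_{(m,D₁)=1} - 𝟙_{(m,D₃)=1} + 𝟙_{(m,D₂)=1}`, `sum_filter_typical_eq`) and
  four applications of Lemma 4.8 with `(2A, 71A)` for `(A, K)` at the integer points of `[Y/2, 3Y]`
  (`norm_partialSum_le`, `lemma48_at_points`: there `q ≤ ℓ^A ≤ (log N)^{2A}` and the sieving primes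
  lie in `(q, N^{1/log log N})` since `P₁ = ℓ^{cA} > ℓ^A ≥ q` and `Q_j ≤ exp(ℓ^{max(2/3, 1-δ/2)})`);
  hence `|S_{h₂}(x)| ≤ η = 24 C₈ Y/(ℓ/2)^K` on `[Y, 2Y]` (`norm_longWindow_le`).
* (5.4)–(5.6): `Lichtman2020.meanSquare_le_of_pieces_trunc` with the two Proposition-5.1 bounds for
  `χ` and `χ̄ = χ⁻¹` at the scale `Y` (the coefficients are complex, whence `χ̄`;
  `star (λ(n)χ(n)) = λ(n)χ⁻¹(n)`).
* Numerics (`numerics_T₀`, `numerics_main`, `numerics_h`, `numerics_Y`, `numerics_eta`):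
  `2000/T₀² + 36C₅(Q₁/h + 1)ℓ^{-B} + 2000/h + 4/Y ≤ (4004 + 72C₅) ℓ^{-10A}`
  (`Q₁/h ≤ W`, `h ≥ H/W⁵ ≥ W¹⁰`, `Y ≥ X/W⁶ ≥ W¹⁰`) and `(h/h₂)² η² Y = (24C₈2^{K})² h² Y ℓ^{-10A}`.
* The growth conditions in `ℓ` (`eventually_cond_a` … `eventually_cond_f`) and the parameter
  inequalities they imply (`h_le_h₂`, `T₀_le_U`, `sqrt_le_U'`, `log_point_bounds`,
  `lt_rpow_inv_loglog`, `lemma48_at_points`).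

## Faithfulness notes

* The statements proved between are the tree's named facts (see their docstrings in
  `MoebiusShiftedPrimesTypical.lean` for the rendering and the documented deviations: `P₁ = ℓ^{cA}`,
  `c ≥ 100`; regime `H ≤ exp(ℓ^{2/3})`; cut-off-free `S_d`; ranges `Y ∈ [X/W⁶, X]`, `0 ≤ T ≤ 2X`).
* The deduction applies Lemma 4.8 with `(2A, 71A)` in place of `(A, K)` and Proposition 5.1 for `χ`
  and `χ⁻¹`; the exponent `c` only enters through `P₁ = ℓ^{cA} > q` (any `c > 1`).

## Source

* J. D. Lichtman, arXiv:2009.08969: "Proof of Proposition 3.4 from Proposition 5.1", (5.1)–(5.6),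
  p. 14; Lemma 4.8, pp. 12–13; Lemmas 4.1, 4.6, p. 12.
-/

noncomputable section

open Filter Asymptotics Finset MeasureTheory
open scoped Topology

namespace Literature.NumberTheory.Sieve

namespace Lichtman2020

open ArithmeticFunction

/-! ### The primes of a real interval and inclusion–exclusion over the typical set ((5.3)) -/

/-! The primes of a closed real interval are the tree's `IntervalSieve.primesIcc`. -/

/-- For `m ≠ 0`: `m` has a prime factor in `[P, Q]` iff some `p ∈ primesIcc P Q` divides `m`. [folklore] -/
theorem hasPrimeFactorIn_iff {P Q : ℝ} {m : ℕ} (hm : m ≠ 0) :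
    HasPrimeFactorIn P Q m ↔ ∃ p ∈ IntervalSieve.primesIcc P Q, p ∣ m := by
  constructor
  · rintro ⟨p, hp, hP, hQ⟩
    rw [Nat.mem_primeFactors] at hp
    exact ⟨p, IntervalSieve.mem_primesIcc.2 ⟨hp.1, hP, hQ⟩, hp.2.1⟩
  · rintro ⟨p, hp, hpm⟩
    rw [IntervalSieve.mem_primesIcc] at hp
    exact ⟨p, Nat.mem_primeFactors.2 ⟨hp.1, hpm, hm⟩, hp.2.1, hp.2.2⟩

/-- For `m ≠ 0`: no prime factor in `[P, Q]` iff no `p ∈ primesIcc P Q` divides `m`. [folklore] -/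
theorem not_hasPrimeFactorIn_iff {P Q : ℝ} {m : ℕ} (hm : m ≠ 0) :
    ¬ HasPrimeFactorIn P Q m ↔ ∀ p ∈ IntervalSieve.primesIcc P Q, ¬ p ∣ m := by
  rw [hasPrimeFactorIn_iff hm]
  push Not
  rfl

/-- **Inclusion–exclusion over the typical set** (p. 14: "`𝟙_{S_d}(m) = ∑_{j=0}^{3} (-1)^j 𝟙_{(m,𝒟_j)=1}`
where `𝒟_j = ∏_{p ∈ 𝒫_j} p` for `𝒫₀ = ∅`, `𝒫₁ = [P₁,Q₁]`, `𝒫₃ = [P₂,Q₂]`, `𝒫₂ = 𝒫₁ ∪ 𝒫₃`"): for any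
`f` and any finset `s` of positive integers,
`∑_{m ∈ s, m ∈ S} f = ∑_s f - ∑_{s, (m,𝒟₁)=1} f - ∑_{s, (m,𝒟₃)=1} f + ∑_{s, (m,𝒟₂)=1} f`.
[cite: Lichtman2020, §5, proof of Proposition 3.4, (5.3)] -/
theorem sum_filter_typical_eq (c' X A δ Hx : ℝ) (f : ℕ → ℂ) {s : Finset ℕ} (hs : ∀ m ∈ s, m ≠ 0) :
    ∑ m ∈ s.filter (lichtmanTypicalWith c' X A δ Hx), f m =
      ∑ m ∈ s, f m
        - ∑ m ∈ s.filter (fun m => ∀ p ∈ IntervalSieve.primesIcc (Real.log X ^ (c' * A)) (Hx / Real.log X ^ (4 * A)),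
            ¬ p ∣ m), f m
        - ∑ m ∈ s.filter (fun m => ∀ p ∈ IntervalSieve.primesIcc (Real.exp (Real.log X ^ (2 / 3 + δ / 2)))
            (Real.exp (Real.log X ^ (1 - δ / 2))), ¬ p ∣ m), f m
        + ∑ m ∈ s.filter (fun m => ∀ p ∈ IntervalSieve.primesIcc (Real.log X ^ (c' * A)) (Hx / Real.log X ^ (4 * A))
            ∪ IntervalSieve.primesIcc (Real.exp (Real.log X ^ (2 / 3 + δ / 2))) (Real.exp (Real.log X ^ (1 - δ / 2))),
            ¬ p ∣ m), f m := by
  set P₁ := Real.log X ^ (c' * A)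
  set Q₁ := Hx / Real.log X ^ (4 * A)
  set P₂ := Real.exp (Real.log X ^ (2 / 3 + δ / 2))
  set Q₂ := Real.exp (Real.log X ^ (1 - δ / 2))
  simp only [Finset.sum_filter]
  rw [← Finset.sum_sub_distrib, ← Finset.sum_sub_distrib, ← Finset.sum_add_distrib]
  refine Finset.sum_congr rfl fun m hm => ?_
  have hm0 := hs m hm
  have e1 : (∀ p ∈ IntervalSieve.primesIcc P₁ Q₁, ¬ p ∣ m) ↔ ¬ HasPrimeFactorIn P₁ Q₁ m :=
    (not_hasPrimeFactorIn_iff hm0).symm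
  have e2 : (∀ p ∈ IntervalSieve.primesIcc P₂ Q₂, ¬ p ∣ m) ↔ ¬ HasPrimeFactorIn P₂ Q₂ m :=
    (not_hasPrimeFactorIn_iff hm0).symm
  have e3 : (∀ p ∈ IntervalSieve.primesIcc P₁ Q₁ ∪ IntervalSieve.primesIcc P₂ Q₂, ¬ p ∣ m) ↔
      ¬ HasPrimeFactorIn P₁ Q₁ m ∧ ¬ HasPrimeFactorIn P₂ Q₂ m := by
    rw [← e1, ← e2]
    simp only [Finset.mem_union, or_imp, forall_and]
  have eS : lichtmanTypicalWith c' X A δ Hx m ↔ HasPrimeFactorIn P₁ Q₁ m ∧ HasPrimeFactorIn P₂ Q₂ m :=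
    Iff.rfl
  simp only [eS, e1, e2, e3]
  by_cases h1 : HasPrimeFactorIn P₁ Q₁ m <;> by_cases h2 : HasPrimeFactorIn P₂ Q₂ m <;> simp [h1, h2]

/-- **(5.3), the partial sums**: if the bound of Lemma 4.8 (constant `C`) is available at the point
`N` for the modulus `q` and the four prime sets `∅`, `𝒫₁`, `𝒫₂`, `𝒫₁ ∪ 𝒫₂`, then
`|∑_{m ≤ N, m ∈ S} λ(m)χ(m)| ≤ 4 C N/(log N)^K`. [cite: Lichtman2020, §5, proof of Proposition 3.4, (5.3)] -/
theorem norm_partialSum_le {c' X A δ Hx C K : ℝ} {q : ℕ} (χ : DirichletCharacter ℂ q) {N : ℕ}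
    (h8 : ∀ P : Finset ℕ, P ⊆ IntervalSieve.primesIcc (Real.log X ^ (c' * A)) (Hx / Real.log X ^ (4 * A))
        ∪ IntervalSieve.primesIcc (Real.exp (Real.log X ^ (2 / 3 + δ / 2))) (Real.exp (Real.log X ^ (1 - δ / 2))) →
      ‖∑ m ∈ (Icc 1 N).filter (fun m => ∀ p ∈ P, ¬ p ∣ m),
          ((liouville m : ℤ) : ℂ) * χ (m : ZMod q)‖ ≤ C * N / Real.log N ^ K) :
    ‖∑ m ∈ (Icc 1 N).filter (lichtmanTypicalWith c' X A δ Hx), ((liouville m : ℤ) : ℂ) * χ (m : ZMod q)‖ ≤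
      4 * (C * N / Real.log N ^ K) := by
  have hs : ∀ m ∈ Icc 1 N, m ≠ 0 := fun m hm => by
    have := (Finset.mem_Icc.1 hm).1; omega
  rw [sum_filter_typical_eq c' X A δ Hx _ hs]
  have h0 := h8 ∅ (Finset.empty_subset _)
  have hall : (Icc 1 N).filter (fun m => ∀ p ∈ (∅ : Finset ℕ), ¬ p ∣ m) = Icc 1 N :=
    Finset.filter_true_of_mem fun m _ => by simp
  rw [hall] at h0
  have h1 := h8 _ Finset.subset_union_left
  have h2 := h8 _ Finset.subset_union_right
  have h3 := h8 _ (Finset.Subset.refl _)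
  calc _ ≤ ‖∑ m ∈ Icc 1 N, ((liouville m : ℤ) : ℂ) * χ (m : ZMod q)‖ + _ + _ + _ :=
        norm_add_le_of_le (norm_sub_le_of_le (norm_sub_le_of_le le_rfl le_rfl) le_rfl) le_rfl
    _ ≤ C * N / Real.log N ^ K + C * N / Real.log N ^ K + C * N / Real.log N ^ K
          + C * N / Real.log N ^ K := by gcongr
    _ = 4 * (C * N / Real.log N ^ K) := by ring

/-- A window as a difference of two partial sums: for `x ≥ 1`, `ℓ ≥ 0`,
`∑_{x ≤ m ≤ x+ℓ, p(m)} f(m) = ∑_{m ≤ ⌊x+ℓ⌋, p(m)} f(m) - ∑_{m ≤ ⌈x⌉-1, p(m)} f(m)`. [folklore] -/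
theorem sum_filter_window_eq_sub (p : ℕ → Prop) [DecidablePred p] (f : ℕ → ℂ) {x ℓ : ℝ}
    (hx : 1 ≤ x) (hℓ : 0 ≤ ℓ) :
    ∑ m ∈ (Icc ⌈x⌉₊ ⌊x + ℓ⌋₊).filter p, f m =
      ∑ m ∈ (Icc 1 ⌊x + ℓ⌋₊).filter p, f m - ∑ m ∈ (Icc 1 (⌈x⌉₊ - 1)).filter p, f m := by
  have h1 : 1 ≤ ⌈x⌉₊ := Nat.one_le_iff_ne_zero.2 (Nat.ceil_pos.2 (by linarith)).ne'
  have h2 : ⌈x⌉₊ - 1 ≤ ⌊x + ℓ⌋₊ := by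
    have h3 : ⌈x⌉₊ ≤ ⌊x⌋₊ + 1 := Nat.ceil_le_floor_add_one x
    have h4 : ⌊x⌋₊ ≤ ⌊x + ℓ⌋₊ := Nat.floor_mono (by linarith)
    omega
  rw [eq_sub_iff_add_eq, Finset.sum_filter, Finset.sum_filter, Finset.sum_filter]
  have hsplit : Icc 1 ⌊x + ℓ⌋₊ = Icc ⌈x⌉₊ ⌊x + ℓ⌋₊ ∪ Icc 1 (⌈x⌉₊ - 1) := by
    ext m; simp only [Finset.mem_union, Finset.mem_Icc]; omega
  have hdisj : Disjoint (Icc ⌈x⌉₊ ⌊x + ℓ⌋₊) (Icc 1 (⌈x⌉₊ - 1)) := by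
    rw [Finset.disjoint_left]
    intro m hm hm'
    rw [Finset.mem_Icc] at hm hm'
    omega
  rw [hsplit, Finset.sum_union hdisj]


/-- **The long windows are small** ((5.3) ⟹ "`S_{h₂}(x) = S_{x+h₂}(0) - S_x(0) ≪ x(log x)^{-K}`"):
if the Lemma-4.8 bound with constant `C` holds at every integer point `N ∈ [Y/2, 3Y]` (for the
modulus `q`, the character `χ` and the subsets of `𝒫₁ ∪ 𝒫₂`), where `log N ≥ ℓ₀ > 0`, then for
`x ∈ [Y, 2Y]`, `0 ≤ h₂ ≤ Y`, `Y ≥ 2`: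
`|∑_{x ≤ m ≤ x+h₂, m ∈ S} λ(m)χ(m)| ≤ 24 C Y/ℓ₀^K`. [cite: Lichtman2020, §5, proof of Proposition 3.4, (5.3)–(5.4)] -/
theorem norm_longWindow_le {c' X A δ Hx C K Y h₂ x ℓ₀ : ℝ} {q : ℕ} (χ : DirichletCharacter ℂ q)
    (hY : 2 ≤ Y) (hh₂ : 0 ≤ h₂) (hh₂Y : h₂ ≤ Y) (hx : x ∈ Set.Icc Y (2 * Y)) (hC : 0 ≤ C)
    (hK : 0 ≤ K) (hℓ₀ : 0 < ℓ₀)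
    (hlog : ∀ N : ℕ, Y / 2 ≤ N → (N : ℝ) ≤ 3 * Y → ℓ₀ ≤ Real.log N)
    (h8 : ∀ N : ℕ, Y / 2 ≤ N → (N : ℝ) ≤ 3 * Y → ∀ P : Finset ℕ,
      P ⊆ IntervalSieve.primesIcc (Real.log X ^ (c' * A)) (Hx / Real.log X ^ (4 * A))
        ∪ IntervalSieve.primesIcc (Real.exp (Real.log X ^ (2 / 3 + δ / 2))) (Real.exp (Real.log X ^ (1 - δ / 2))) →
      ‖∑ m ∈ (Icc 1 N).filter (fun m => ∀ p ∈ P, ¬ p ∣ m),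
          ((liouville m : ℤ) : ℂ) * χ (m : ZMod q)‖ ≤ C * N / Real.log N ^ K) :
    ‖∑ m ∈ (Icc ⌈x⌉₊ ⌊x + h₂⌋₊).filter (lichtmanTypicalWith c' X A δ Hx),
        ((liouville m : ℤ) : ℂ) * χ (m : ZMod q)‖ ≤ 24 * C * Y / ℓ₀ ^ K := by
  obtain ⟨hxY, hx2Y⟩ := hx
  have hx1 : 1 ≤ x := by linarith
  -- the bound at an admissible `N`
  have key : ∀ N : ℕ, Y / 2 ≤ N → (N : ℝ) ≤ 3 * Y →
      ‖∑ m ∈ (Icc 1 N).filter (lichtmanTypicalWith c' X A δ Hx), ((liouville m : ℤ) : ℂ) * χ (m : ZMod q)‖ ≤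
        12 * C * Y / ℓ₀ ^ K := by
    intro N hN1 hN2
    refine (norm_partialSum_le χ (h8 N hN1 hN2)).trans ?_
    have hlogN : ℓ₀ ≤ Real.log N := hlog N hN1 hN2
    have hpow : ℓ₀ ^ K ≤ Real.log N ^ K := Real.rpow_le_rpow hℓ₀.le hlogN hK
    have hpos : 0 < ℓ₀ ^ K := Real.rpow_pos_of_pos hℓ₀ K
    calc 4 * (C * N / Real.log N ^ K) ≤ 4 * (C * (3 * Y) / ℓ₀ ^ K) := by
          gcongr
      _ = 12 * C * Y / ℓ₀ ^ K := by ring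
  rw [sum_filter_window_eq_sub _ _ hx1 hh₂]
  -- the two end points are admissible
  have hN₂a : Y / 2 ≤ (⌊x + h₂⌋₊ : ℕ) := by
    have := Nat.lt_floor_add_one (x + h₂)
    linarith
  have hN₂b : ((⌊x + h₂⌋₊ : ℕ) : ℝ) ≤ 3 * Y := (Nat.floor_le (by linarith)).trans (by linarith)
  have hc1 : 1 ≤ ⌈x⌉₊ := Nat.one_le_iff_ne_zero.2 (Nat.ceil_pos.2 (by linarith)).ne'
  have hcast : (((⌈x⌉₊ - 1 : ℕ)) : ℝ) = (⌈x⌉₊ : ℝ) - 1 := by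
    rw [Nat.cast_sub hc1, Nat.cast_one]
  have hN₁a : Y / 2 ≤ ((⌈x⌉₊ - 1 : ℕ) : ℝ) := by
    rw [hcast]
    have := Nat.le_ceil x
    linarith
  have hN₁b : ((⌈x⌉₊ - 1 : ℕ) : ℝ) ≤ 3 * Y := by
    rw [hcast]
    have := (Nat.ceil_lt_add_one (by linarith : 0 ≤ x)).le
    linarith
  calc _ ≤ ‖∑ m ∈ (Icc 1 ⌊x + h₂⌋₊).filter (lichtmanTypicalWith c' X A δ Hx), ((liouville m : ℤ) : ℂ) * χ (m : ZMod q)‖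
        + ‖∑ m ∈ (Icc 1 (⌈x⌉₊ - 1)).filter (lichtmanTypicalWith c' X A δ Hx), ((liouville m : ℤ) : ℂ) * χ (m : ZMod q)‖ :=
        norm_sub_le _ _
    _ ≤ 12 * C * Y / ℓ₀ ^ K + 12 * C * Y / ℓ₀ ^ K := add_le_add (key _ hN₂a hN₂b) (key _ hN₁a hN₁b)
    _ = 24 * C * Y / ℓ₀ ^ K := by ring

/-! ### Growth lemmas -/

/-- Master growth bound: for `E < 1`, `M > 0`, eventually `M (log log X + (log X)^E + 1) ≤ log X`. [folklore] -/
theorem eventually_growth (E M : ℝ) (hE : E < 1) (hM : 0 < M) :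
    ∀ᶠ X : ℕ in atTop, M * (Real.log (Real.log X) + Real.log X ^ E + 1) ≤ Real.log X := by
  have h3M : (0 : ℝ) < 1 / (3 * M) := by positivity
  have h1 : ∀ᶠ X : ℕ in atTop, Real.log (Real.log X) ≤ 1 / (3 * M) * Real.log X ^ (1 : ℝ) :=
    (eventually_loglog_le 1 _ one_pos h3M).natCast_atTop
      |>.mono fun X hX => by simpa using hX
  have h2 : ∀ᶠ X : ℕ in atTop, Real.log X ^ (E - 1) ≤ 1 / (3 * M) := by
    have ht := (tendsto_rpow_neg_atTop (by linarith : 0 < 1 - E)).comp tendsto_log_natCast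
    have := ht.eventually (ge_mem_nhds h3M)
    refine this.mono fun X hX => ?_
    simpa [show -(1 - E) = E - 1 by ring] using hX
  filter_upwards [h1, h2, tendsto_log_natCast.eventually_ge_atTop (max 1 (3 * M))] with X hX1 hX2 hX3
  have hℓ1 : 1 ≤ Real.log X := (le_max_left _ _).trans hX3
  have hℓM : 3 * M ≤ Real.log X := (le_max_right _ _).trans hX3
  have hℓ0 : 0 < Real.log X := by linarith
  have hE' : Real.log X ^ E ≤ 1 / (3 * M) * Real.log X := by
    have : Real.log X ^ E = Real.log X ^ (E - 1) * Real.log X := by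
      rw [← Real.rpow_add_one hℓ0.ne']; ring_nf
    rw [this]
    exact mul_le_mul_of_nonneg_right hX2 hℓ0.le
  rw [Real.rpow_one] at hX1
  have h1' : M * Real.log (Real.log X) ≤ Real.log X / 3 := by
    calc M * Real.log (Real.log X) ≤ M * (1 / (3 * M) * Real.log X) :=
          mul_le_mul_of_nonneg_left hX1 hM.le
      _ = Real.log X / 3 := by field_simp
  have h2' : M * Real.log X ^ E ≤ Real.log X / 3 := by
    calc M * Real.log X ^ E ≤ M * (1 / (3 * M) * Real.log X) := mul_le_mul_of_nonneg_left hE' hM.le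
      _ = Real.log X / 3 := by field_simp
  have h3' : M * 1 ≤ Real.log X / 3 := by linarith
  linarith

/-- Eventually `log log X ≤ ε (log X)^c`, along `ℕ` (`c, ε > 0`). [folklore] -/
theorem eventually_loglog_le_natCast (c ε : ℝ) (hc : 0 < c) (hε : 0 < ε) :
    ∀ᶠ X : ℕ in atTop, Real.log (Real.log X) ≤ ε * Real.log X ^ c :=
  (eventually_loglog_le c ε hc hε).natCast_atTop


/-! ### Numerics in `ℓ = log X` -/

/-- (n1) `2000/T₀² ≤ 2000 ℓ^{-10A}` for `T₀ = ℓ^{22A}`, `ℓ ≥ 1`, `A ≥ 0`. [folklore] -/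
theorem numerics_T₀ {ℓ A : ℝ} (hℓ : 1 ≤ ℓ) (hA : 0 ≤ A) :
    2000 / (ℓ ^ (22 * A)) ^ 2 ≤ 2000 * (1 / ℓ ^ (10 * A)) := by
  have hℓ0 : 0 < ℓ := by linarith
  have e : (ℓ ^ (22 * A)) ^ 2 = ℓ ^ (44 * A) := by
    rw [← Real.rpow_natCast, ← Real.rpow_mul hℓ0.le]; ring_nf
  rw [e, mul_one_div]
  exact div_le_div_of_nonneg_left (by norm_num) (Real.rpow_pos_of_pos hℓ0 _)
    (Real.rpow_le_rpow_of_exponent_le hℓ (by nlinarith))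

/-- (n2) `Q₁/h ≤ ℓ^A` for `Q₁ = H/ℓ^{4A}`, `h ≥ H/ℓ^{5A}`, `H > 0`. [folklore] -/
theorem numerics_Q_div_h {ℓ A Hx h : ℝ} (hℓ : 1 ≤ ℓ) (hHx : 0 < Hx) (hh : Hx / ℓ ^ (5 * A) ≤ h) :
    Hx / ℓ ^ (4 * A) / h ≤ ℓ ^ A := by
  have hℓ0 : 0 < ℓ := by linarith
  have h5 : 0 < ℓ ^ (5 * A) := Real.rpow_pos_of_pos hℓ0 _
  have h4 : 0 < ℓ ^ (4 * A) := Real.rpow_pos_of_pos hℓ0 _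
  have hh0 : 0 < h := lt_of_lt_of_le (by positivity) hh
  rw [div_div, div_le_iff₀ (by positivity)]
  have e : ℓ ^ (5 * A) = ℓ ^ A * ℓ ^ (4 * A) := by
    rw [← Real.rpow_add hℓ0]; ring_nf
  rw [div_le_iff₀ h5, e] at hh
  nlinarith

/-- (n2') `36 C₅ (Q₁/h + 1) L ≤ 72 C₅ ℓ^{-10A}` (`L = ℓ^{-11A}`). [folklore] -/
theorem numerics_main {ℓ A C₅ Hx h : ℝ} (hℓ : 1 ≤ ℓ) (hA : 0 ≤ A) (hC₅ : 0 ≤ C₅) (hHx : 0 < Hx)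
    (hh : Hx / ℓ ^ (5 * A) ≤ h) :
    36 * C₅ * (Hx / ℓ ^ (4 * A) / h + 1) * (1 / ℓ ^ (11 * A)) ≤ 72 * C₅ * (1 / ℓ ^ (10 * A)) := by
  have hℓ0 : 0 < ℓ := by linarith
  have hQ := numerics_Q_div_h hℓ hHx hh (A := A)
  have hA1 : 1 ≤ ℓ ^ A := Real.one_le_rpow hℓ hA
  have h11 : 0 < ℓ ^ (11 * A) := Real.rpow_pos_of_pos hℓ0 _
  have e : ℓ ^ (11 * A) = ℓ ^ A * ℓ ^ (10 * A) := by
    rw [← Real.rpow_add hℓ0]; ring_nf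
  calc 36 * C₅ * (Hx / ℓ ^ (4 * A) / h + 1) * (1 / ℓ ^ (11 * A))
      ≤ 36 * C₅ * (ℓ ^ A + ℓ ^ A) * (1 / ℓ ^ (11 * A)) := by gcongr
    _ = 72 * C₅ * (ℓ ^ A / ℓ ^ (11 * A)) := by ring
    _ = 72 * C₅ * (1 / ℓ ^ (10 * A)) := by
        rw [e, ← div_div, div_self (by positivity)]

/-- (n3) `2000/h ≤ 2000 ℓ^{-10A}` for `h ≥ H/ℓ^{5A}`, `H ≥ ℓ^{15A}`. [folklore] -/
theorem numerics_h {ℓ A Hx h : ℝ} (hℓ : 1 ≤ ℓ) (hHx : ℓ ^ (15 * A) ≤ Hx)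
    (hh : Hx / ℓ ^ (5 * A) ≤ h) : 2000 / h ≤ 2000 * (1 / ℓ ^ (10 * A)) := by
  have hℓ0 : 0 < ℓ := by linarith
  have h15 : 0 < ℓ ^ (15 * A) := Real.rpow_pos_of_pos hℓ0 _
  have h5 : 0 < ℓ ^ (5 * A) := Real.rpow_pos_of_pos hℓ0 _
  have hHx0 : 0 < Hx := h15.trans_le hHx
  have hh0 : 0 < h := lt_of_lt_of_le (by positivity) hh
  have e : ℓ ^ (15 * A) = ℓ ^ (10 * A) * ℓ ^ (5 * A) := by
    rw [← Real.rpow_add hℓ0]; ring_nf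
  have h10 : ℓ ^ (10 * A) ≤ h := by
    refine le_trans ?_ hh
    rw [le_div_iff₀ h5, ← e]
    exact hHx
  rw [mul_one_div]
  exact div_le_div_of_nonneg_left (by norm_num) (Real.rpow_pos_of_pos hℓ0 _) h10

/-- (n4) `4/Y ≤ 4 ℓ^{-10A}` for `Y ≥ X/ℓ^{6A}`, `X ≥ ℓ^{16A}`. [folklore] -/
theorem numerics_Y {ℓ A X Y : ℝ} (hℓ : 1 ≤ ℓ) (hX : ℓ ^ (16 * A) ≤ X) (hY : X / ℓ ^ (6 * A) ≤ Y) :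
    4 / Y ≤ 4 * (1 / ℓ ^ (10 * A)) := by
  have hℓ0 : 0 < ℓ := by linarith
  have h16 : 0 < ℓ ^ (16 * A) := Real.rpow_pos_of_pos hℓ0 _
  have h6 : 0 < ℓ ^ (6 * A) := Real.rpow_pos_of_pos hℓ0 _
  have hX0 : 0 < X := h16.trans_le hX
  have e : ℓ ^ (16 * A) = ℓ ^ (10 * A) * ℓ ^ (6 * A) := by
    rw [← Real.rpow_add hℓ0]; ring_nf
  have h10 : ℓ ^ (10 * A) ≤ Y := by
    refine le_trans ?_ hY
    rw [le_div_iff₀ h6, ← e]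
    exact hX
  rw [mul_one_div]
  exact div_le_div_of_nonneg_left (by norm_num) (Real.rpow_pos_of_pos hℓ0 _) h10

/-- (n5) The long-window term: `(h/h₂)² η² Y = (24 C₈ 2^{71A})² h² Y ℓ^{-10A}` for
`h₂ = Y/ℓ^{66A}`, `η = 24 C₈ Y/(ℓ/2)^{71A}`. [folklore] -/
theorem numerics_eta {ℓ A C₈ h Y : ℝ} (hℓ : 1 ≤ ℓ) (hY : 0 < Y) :
    2 * (h / (Y / (ℓ ^ (22 * A)) ^ 3)) ^ 2 * (24 * C₈ * Y / (ℓ / 2) ^ (71 * A)) ^ 2 * Y =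
      2 * (24 * C₈ * 2 ^ (71 * A)) ^ 2 * (h ^ 2 * Y * (1 / ℓ ^ (10 * A))) := by
  have hℓ0 : 0 < ℓ := by linarith
  have e1 : (ℓ ^ (22 * A)) ^ 3 = ℓ ^ (66 * A) := by
    rw [← Real.rpow_natCast, ← Real.rpow_mul hℓ0.le]; ring_nf
  have e2 : (ℓ / 2) ^ (71 * A) = ℓ ^ (71 * A) / 2 ^ (71 * A) := Real.div_rpow hℓ0.le (by norm_num) _
  have h66 : 0 < ℓ ^ (66 * A) := Real.rpow_pos_of_pos hℓ0 _
  have h71 : 0 < ℓ ^ (71 * A) := Real.rpow_pos_of_pos hℓ0 _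
  have h10 : 0 < ℓ ^ (10 * A) := Real.rpow_pos_of_pos hℓ0 _
  have h2 : (0 : ℝ) < 2 ^ (71 * A) := Real.rpow_pos_of_pos (by norm_num) _
  have e3 : (ℓ ^ (66 * A)) ^ 2 * ℓ ^ (10 * A) = (ℓ ^ (71 * A)) ^ 2 := by
    rw [← Real.rpow_natCast, ← Real.rpow_natCast (ℓ ^ (71 * A)), ← Real.rpow_mul hℓ0.le,
      ← Real.rpow_mul hℓ0.le, ← Real.rpow_add hℓ0]
    ring_nf
  rw [e1, e2]
  field_simp
  rw [show A * 10 = 10 * A by ring, show A * 71 = 71 * A by ring, ← e3]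
  ring


/-! ### Eventual inequalities in `ℓ = log X` -/

/-- Eventually `log log X ≤ ε log X` (`ε > 0`). [folklore] -/
theorem eventually_loglog_le_mul_log {ε : ℝ} (hε : 0 < ε) :
    ∀ᶠ X : ℕ in atTop, Real.log (Real.log X) ≤ ε * Real.log X := by
  filter_upwards [eventually_loglog_le_natCast 1 ε one_pos hε] with X hX
  rwa [Real.rpow_one] at hX

/-- Eventually `(log X)^E ≤ ε log X` (`E < 1`, `ε > 0`). [folklore] -/
theorem eventually_rpow_log_le_mul_log {E ε : ℝ} (hE : E < 1) (hε : 0 < ε) :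
    ∀ᶠ X : ℕ in atTop, Real.log X ^ E ≤ ε * Real.log X := by
  have ht := (tendsto_rpow_neg_atTop (by linarith : 0 < 1 - E)).comp tendsto_log_natCast
  filter_upwards [ht.eventually (ge_mem_nhds hε), tendsto_log_natCast.eventually_gt_atTop 0]
    with X hX hℓ0
  have e : Real.log X ^ E = Real.log X ^ (-(1 - E)) * Real.log X := by
    rw [← Real.rpow_add_one hℓ0.ne']; ring_nf
  rw [e]
  exact mul_le_mul_of_nonneg_right hX hℓ0.le

/-- (a) Eventually `log 2 + 6A log ℓ ≤ ℓ/2` (`ℓ = log X`). [folklore] -/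
theorem eventually_cond_a {A : ℝ} (hA : 0 < A) :
    ∀ᶠ X : ℕ in atTop, Real.log 2 + 6 * A * Real.log (Real.log X) ≤ Real.log X / 2 := by
  filter_upwards [eventually_loglog_le_mul_log (by positivity : 0 < 1 / (24 * A)),
    tendsto_log_natCast.eventually_ge_atTop 4] with X h1 h2
  have h3 : 6 * A * Real.log (Real.log X) ≤ Real.log X / 4 := by
    calc 6 * A * Real.log (Real.log X) ≤ 6 * A * (1 / (24 * A) * Real.log X) :=
          mul_le_mul_of_nonneg_left h1 (by positivity)
      _ = Real.log X / 4 := by field_simp; ring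
  have h4 : Real.log 2 ≤ 1 := by
    have := Real.log_le_sub_one_of_pos (by norm_num : (0 : ℝ) < 2); linarith
  linarith

/-- (b) Eventually `ℓ^{2/3} + 72A log ℓ ≤ ℓ`. [folklore] -/
theorem eventually_cond_b {A : ℝ} (hA : 0 < A) :
    ∀ᶠ X : ℕ in atTop, Real.log X ^ (2 / 3 : ℝ) + 72 * A * Real.log (Real.log X) ≤ Real.log X := by
  filter_upwards [eventually_loglog_le_mul_log (by positivity : 0 < 1 / (144 * A)),
    eventually_rpow_log_le_mul_log (by norm_num : (2 / 3 : ℝ) < 1) (by norm_num : (0 : ℝ) < 1 / 2)]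
    with X h1 h2
  have h3 : 72 * A * Real.log (Real.log X) ≤ Real.log X / 2 := by
    calc 72 * A * Real.log (Real.log X) ≤ 72 * A * (1 / (144 * A) * Real.log X) :=
          mul_le_mul_of_nonneg_left h1 (by positivity)
      _ = Real.log X / 2 := by field_simp; ring
  linarith

/-- (d) Eventually `log 2 + 2ℓ^{2/3} + 6A log ℓ ≤ ℓ`. [folklore] -/
theorem eventually_cond_d {A : ℝ} (hA : 0 < A) :
    ∀ᶠ X : ℕ in atTop, Real.log 2 + 2 * Real.log X ^ (2 / 3 : ℝ) + 6 * A * Real.log (Real.log X)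
      ≤ Real.log X := by
  filter_upwards [eventually_cond_a hA,
    eventually_rpow_log_le_mul_log (by norm_num : (2 / 3 : ℝ) < 1) (by norm_num : (0 : ℝ) < 1 / 4)]
    with X h1 h2
  linarith

/-- (e) Eventually `A log ℓ + 1 ≤ ℓ^{2/3}`. [folklore] -/
theorem eventually_cond_e {A : ℝ} (hA : 0 < A) :
    ∀ᶠ X : ℕ in atTop, A * Real.log (Real.log X) + 1 ≤ Real.log X ^ (2 / 3 : ℝ) := by
  have h23 : (0 : ℝ) < 2 / 3 := by norm_num
  filter_upwards [eventually_loglog_le_natCast (2 / 3) (1 / (2 * A)) h23 (by positivity),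
    ((tendsto_rpow_atTop h23).comp tendsto_log_natCast).eventually_ge_atTop 2] with X h1 h2
  have h3 : A * Real.log (Real.log X) ≤ Real.log X ^ (2 / 3 : ℝ) / 2 := by
    calc A * Real.log (Real.log X) ≤ A * (1 / (2 * A) * Real.log X ^ (2 / 3 : ℝ)) :=
          mul_le_mul_of_nonneg_left h1 hA.le
      _ = Real.log X ^ (2 / 3 : ℝ) / 2 := by field_simp
  have h2' : (2 : ℝ) ≤ Real.log X ^ (2 / 3 : ℝ) := h2
  linarith

/-- (f) Eventually `8 log ℓ · ℓ^E < ℓ` (`E < 1`). [folklore] -/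
theorem eventually_cond_f {E : ℝ} (hE : E < 1) :
    ∀ᶠ X : ℕ in atTop, 8 * Real.log (Real.log X) * Real.log X ^ E < Real.log X := by
  have hγ : 0 < (1 - E) / 2 := by linarith
  filter_upwards [eventually_loglog_le_natCast ((1 - E) / 2) (1 / 16) hγ (by norm_num),
    tendsto_log_natCast.eventually_ge_atTop 1,
    (Real.tendsto_log_atTop.comp tendsto_log_natCast).eventually_ge_atTop 0] with X h1 hℓ1 hll0
  have hℓ0 : 0 < Real.log X := by linarith
  have hE0 : 0 ≤ Real.log X ^ E := Real.rpow_nonneg hℓ0.le E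
  have h2 : Real.log X ^ ((1 - E) / 2) * Real.log X ^ E ≤ Real.log X := by
    rw [← Real.rpow_add hℓ0]
    calc Real.log X ^ ((1 - E) / 2 + E) ≤ Real.log X ^ (1 : ℝ) := Real.rpow_le_rpow_of_exponent_le hℓ1 (by linarith)
      _ = Real.log X := Real.rpow_one _
  have hll0' : (0 : ℝ) ≤ Real.log (Real.log X) := hll0
  calc 8 * Real.log (Real.log X) * Real.log X ^ E
      ≤ 8 * (1 / 16 * Real.log X ^ ((1 - E) / 2)) * Real.log X ^ E := by gcongr
    _ = (Real.log X ^ ((1 - E) / 2) * Real.log X ^ E) / 2 := by ring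
    _ ≤ Real.log X / 2 := by gcongr
    _ < Real.log X := by linarith

/-! ### Parameter inequalities -/

/-- Logarithms of the integer points of `[Y/2, 3Y]`: `ℓ/2 ≤ log N ≤ 2ℓ`. [folklore] -/
theorem log_point_bounds {X A N : ℝ} (hX : 1 < X) (hℓ2 : 2 ≤ Real.log X)
    (hG : Real.log 2 + 6 * A * Real.log (Real.log X) ≤ Real.log X / 2)
    (hN1 : X / (2 * Real.log X ^ (6 * A)) ≤ N) (hN2 : N ≤ 3 * X) :
    Real.log X / 2 ≤ Real.log N ∧ Real.log N ≤ 2 * Real.log X := by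
  have hX0 : 0 < X := by linarith
  have hℓ0 : 0 < Real.log X := by linarith
  have h6 : 0 < Real.log X ^ (6 * A) := Real.rpow_pos_of_pos hℓ0 _
  have hN0 : 0 < N := lt_of_lt_of_le (by positivity) hN1
  constructor
  · have h1 : Real.log (X / (2 * Real.log X ^ (6 * A))) ≤ Real.log N := Real.log_le_log (by positivity) hN1
    rw [Real.log_div hX0.ne' (by positivity), Real.log_mul (by norm_num) h6.ne',
      Real.log_rpow hℓ0] at h1
    linarith
  · have h1 : Real.log N ≤ Real.log (3 * X) := Real.log_le_log hN0 hN2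
    rw [Real.log_mul (by norm_num) hX0.ne'] at h1
    have h3 : Real.log 3 ≤ 2 := by
      have := Real.log_le_sub_one_of_pos (by norm_num : (0 : ℝ) < 3); linarith
    linarith

/-- `q ≤ ℓ^A ≤ (log N)^{2A}` when `log N ≥ ℓ/2`, `ℓ ≥ 4`. [folklore] -/
theorem rpow_le_rpow_log_point {ℓ A u : ℝ} (hℓ : 4 ≤ ℓ) (hA : 0 ≤ A) (hu : ℓ / 2 ≤ u) :
    ℓ ^ A ≤ u ^ (2 * A) := by
  have hℓ0 : 0 < ℓ := by linarith
  have h1 : ℓ ≤ (ℓ / 2) ^ 2 := by nlinarith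
  calc ℓ ^ A ≤ ((ℓ / 2) ^ 2) ^ A := Real.rpow_le_rpow hℓ0.le h1 hA
    _ = (ℓ / 2) ^ (2 * A) := by rw [← Real.rpow_natCast, ← Real.rpow_mul (by positivity)]; norm_num
    _ ≤ u ^ (2 * A) := Real.rpow_le_rpow (by positivity) hu (by positivity)

/-- The sieving primes are below `N^{1/log log N}`: if `ℓ/2 ≤ log N ≤ 2ℓ`, `ℓ ≥ 4`,
`p ≤ exp(ℓ^E)` and `8 log ℓ · ℓ^E < ℓ`, then `p < N^{1/log log N}`. [folklore] -/
theorem lt_rpow_inv_loglog {ℓ E p N : ℝ} (hℓ : 4 ≤ ℓ) (hN0 : 0 < N) (hlo : ℓ / 2 ≤ Real.log N)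
    (hhi : Real.log N ≤ 2 * ℓ) (hp : p ≤ Real.exp (ℓ ^ E))
    (hG : 8 * Real.log ℓ * ℓ ^ E < ℓ) : p < N ^ (1 / Real.log (Real.log N)) := by
  have hℓ0 : 0 < ℓ := by linarith
  set u := Real.log N with hu
  have hu2 : 2 ≤ u := by linarith
  have hlogℓ : 0 < Real.log ℓ := Real.log_pos (by linarith)
  have hlog2 : 0 < Real.log 2 := Real.log_pos (by norm_num)
  have hlu0 : 0 < Real.log u := Real.log_pos (by linarith)
  -- `log u ≤ 2 log ℓ`
  have hlu : Real.log u ≤ 2 * Real.log ℓ := by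
    have h1 : Real.log u ≤ Real.log (2 * ℓ) := Real.log_le_log (by linarith) hhi
    rw [Real.log_mul (by norm_num) hℓ0.ne'] at h1
    have h2 : Real.log 2 ≤ Real.log ℓ := Real.log_le_log (by norm_num) (by linarith)
    linarith
  -- `ℓ^E < u / log u`
  have hE : ℓ ^ E < u / Real.log u := by
    rw [lt_div_iff₀ hlu0]
    have hE0 : 0 ≤ ℓ ^ E := Real.rpow_nonneg hℓ0.le E
    calc ℓ ^ E * Real.log u ≤ ℓ ^ E * (2 * Real.log ℓ) := mul_le_mul_of_nonneg_left hlu hE0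
      _ = (8 * Real.log ℓ * ℓ ^ E) / 4 := by ring
      _ < ℓ / 4 := by gcongr
      _ ≤ u / 2 := by linarith
      _ ≤ u := by linarith
  rw [Real.rpow_def_of_pos hN0, ← hu, one_div, ← div_eq_mul_inv]
  exact lt_of_le_of_lt hp (Real.exp_lt_exp.2 hE)

/-- `X / ℓ^{c} = exp(ℓ - c log ℓ)` for `X = e^ℓ`, `ℓ > 0`. [folklore] -/
theorem div_rpow_log_eq_exp {X ℓ c : ℝ} (hX : Real.exp ℓ = X) (hℓ : 0 < ℓ) :
    X / ℓ ^ c = Real.exp (ℓ - c * Real.log ℓ) := by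
  rw [Real.exp_sub, hX, Real.rpow_def_of_pos hℓ, mul_comm]

/-- `h ≤ h₂ = Y/T₀³`: from `h ≤ H ≤ exp(ℓ^{2/3})`, `Y ≥ X/ℓ^{6A}`, `ℓ^{2/3} + 72A log ℓ ≤ ℓ`. [folklore] -/
theorem h_le_h₂ {X ℓ A Hx h Y : ℝ} (hX : Real.exp ℓ = X) (hℓ : 1 ≤ ℓ) (hh : h ≤ Hx)
    (hHx : Hx ≤ Real.exp (ℓ ^ (2 / 3 : ℝ))) (hY : X / ℓ ^ (6 * A) ≤ Y)
    (hG : ℓ ^ (2 / 3 : ℝ) + 72 * A * Real.log ℓ ≤ ℓ) : h ≤ Y / (ℓ ^ (22 * A)) ^ 3 := by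
  have hℓ0 : 0 < ℓ := by linarith
  have e1 : (ℓ ^ (22 * A)) ^ 3 = ℓ ^ (66 * A) := by
    rw [← Real.rpow_natCast, ← Real.rpow_mul hℓ0.le]; ring_nf
  have h66 : 0 < ℓ ^ (66 * A) := Real.rpow_pos_of_pos hℓ0 _
  have h6 : 0 < ℓ ^ (6 * A) := Real.rpow_pos_of_pos hℓ0 _
  rw [e1]
  have h1 : X / ℓ ^ (6 * A) / ℓ ^ (66 * A) ≤ Y / ℓ ^ (66 * A) :=
    div_le_div_of_nonneg_right hY h66.le
  refine le_trans ?_ h1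
  rw [div_div, ← Real.rpow_add hℓ0, show 6 * A + 66 * A = 72 * A by ring,
    div_rpow_log_eq_exp hX hℓ0]
  exact hh.trans (hHx.trans (Real.exp_le_exp.2 (by linarith)))

/-- `T₀ = ℓ^{22A} ≤ Y/h`: from `h ≤ exp(ℓ^{2/3})`, `Y ≥ X/ℓ^{6A}`, `ℓ^{2/3} + 72A log ℓ ≤ ℓ`. [folklore] -/
theorem T₀_le_U {X ℓ A Hx h Y : ℝ} (hX : Real.exp ℓ = X) (hℓ : 1 ≤ ℓ) (hA : 0 ≤ A) (hh0 : 0 < h)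
    (hh : h ≤ Hx) (hHx : Hx ≤ Real.exp (ℓ ^ (2 / 3 : ℝ))) (hY : X / ℓ ^ (6 * A) ≤ Y)
    (hG : ℓ ^ (2 / 3 : ℝ) + 72 * A * Real.log ℓ ≤ ℓ) : ℓ ^ (22 * A) ≤ Y / h := by
  have hℓ0 : 0 < ℓ := by linarith
  have hlogℓ : 0 ≤ Real.log ℓ := Real.log_nonneg hℓ
  have h6 : 0 < ℓ ^ (6 * A) := Real.rpow_pos_of_pos hℓ0 _
  have hX0 : 0 < X := by rw [← hX]; exact Real.exp_pos _
  have hE : h ≤ Real.exp (ℓ ^ (2 / 3 : ℝ)) := hh.trans hHx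
  have h1 : X / ℓ ^ (6 * A) / Real.exp (ℓ ^ (2 / 3 : ℝ)) ≤ Y / h := by
    calc X / ℓ ^ (6 * A) / Real.exp (ℓ ^ (2 / 3 : ℝ)) ≤ Y / Real.exp (ℓ ^ (2 / 3 : ℝ)) :=
          div_le_div_of_nonneg_right hY (Real.exp_pos _).le
      _ ≤ Y / h := div_le_div_of_nonneg_left (by
          have : 0 < X / ℓ ^ (6 * A) := by positivity
          linarith) hh0 hE
  refine le_trans ?_ h1
  rw [div_rpow_log_eq_exp hX hℓ0, ← Real.exp_sub, Real.rpow_def_of_pos hℓ0]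
  exact Real.exp_le_exp.2 (by nlinarith)

/-- `√(2Y) ≤ Y/h`: from `h ≤ exp(ℓ^{2/3})`, `Y ≥ X/ℓ^{6A}`, `log 2 + 2ℓ^{2/3} + 6A log ℓ ≤ ℓ`. [folklore] -/
theorem sqrt_le_U {X ℓ A Hx h Y : ℝ} (hX : Real.exp ℓ = X) (hℓ : 1 ≤ ℓ) (hh0 : 0 < h)
    (hh : h ≤ Hx) (hHx : Hx ≤ Real.exp (ℓ ^ (2 / 3 : ℝ))) (hY : X / ℓ ^ (6 * A) ≤ Y)
    (hG : Real.log 2 + 2 * ℓ ^ (2 / 3 : ℝ) + 6 * A * Real.log ℓ ≤ ℓ) :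
    (2 * Y) ^ (1 / 2 : ℝ) ≤ Y / h := by
  have hℓ0 : 0 < ℓ := by linarith
  have h6 : 0 < ℓ ^ (6 * A) := Real.rpow_pos_of_pos hℓ0 _
  have hX0 : 0 < X := by rw [← hX]; exact Real.exp_pos _
  have hY0 : 0 < Y := lt_of_lt_of_le (by positivity) hY
  -- `2 h² ≤ Y`
  have hE : h ≤ Real.exp (ℓ ^ (2 / 3 : ℝ)) := hh.trans hHx
  have h2 : 2 * h ^ 2 ≤ Y := by
    have h3 : 2 * h ^ 2 ≤ 2 * Real.exp (ℓ ^ (2 / 3 : ℝ)) ^ 2 := by gcongr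
    refine h3.trans (le_trans ?_ hY)
    rw [div_rpow_log_eq_exp hX hℓ0, ← Real.exp_nat_mul,
      show (2 : ℝ) = Real.exp (Real.log 2) by rw [Real.exp_log (by norm_num)], ← Real.exp_add,
      Real.exp_log (by norm_num)]
    exact Real.exp_le_exp.2 (by push_cast; linarith)
  -- square both sides
  have hU0 : 0 ≤ Y / h := by positivity
  rw [← pow_le_pow_iff_left₀ (Real.rpow_nonneg (by positivity) _) hU0 two_ne_zero,
    ← Real.rpow_natCast, ← Real.rpow_mul (by positivity)]
  norm_num
  rw [div_pow, le_div_iff₀ (by positivity)]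
  nlinarith

/-- `√Y ≤ Y/h` under the hypotheses of `sqrt_le_U`. [folklore] -/
theorem sqrt_le_U' {X ℓ A Hx h Y : ℝ} (hX : Real.exp ℓ = X) (hℓ : 1 ≤ ℓ) (hh0 : 0 < h)
    (hh : h ≤ Hx) (hHx : Hx ≤ Real.exp (ℓ ^ (2 / 3 : ℝ))) (hY : X / ℓ ^ (6 * A) ≤ Y)
    (hG : Real.log 2 + 2 * ℓ ^ (2 / 3 : ℝ) + 6 * A * Real.log ℓ ≤ ℓ) :
    Y ^ (1 / 2 : ℝ) ≤ Y / h := by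
  have hℓ0 : 0 < ℓ := by linarith
  have hX0 : 0 < X := by rw [← hX]; exact Real.exp_pos _
  have h6 : 0 < ℓ ^ (6 * A) := Real.rpow_pos_of_pos hℓ0 _
  have hY0 : 0 < Y := lt_of_lt_of_le (by positivity) hY
  exact (Real.rpow_le_rpow hY0.le (by linarith) (by norm_num)).trans
    (sqrt_le_U hX hℓ hh0 hh hHx hY hG)

/-- `X^{1/2} ≤ X/ℓ^{6A}` from `6A log ℓ ≤ ℓ/2`. [folklore] -/
theorem sqrt_le_div_rpow {X ℓ A : ℝ} (hX : Real.exp ℓ = X) (hℓ : 0 < ℓ)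
    (hG : 6 * A * Real.log ℓ ≤ ℓ / 2) : X ^ (1 / 2 : ℝ) ≤ X / ℓ ^ (6 * A) := by
  have hX0 : 0 < X := by rw [← hX]; exact Real.exp_pos _
  rw [div_rpow_log_eq_exp hX hℓ, Real.rpow_def_of_pos hX0, ← hX, Real.log_exp]
  exact Real.exp_le_exp.2 (by linarith)

/-- `ℓ^{c} ≤ X` from `c log ℓ ≤ ℓ` (`X = e^ℓ`). [folklore] -/
theorem rpow_log_le_self {X ℓ c : ℝ} (hX : Real.exp ℓ = X) (hℓ : 0 < ℓ)
    (hG : c * Real.log ℓ ≤ ℓ) : ℓ ^ c ≤ X := by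
  rw [Real.rpow_def_of_pos hℓ, ← hX, mul_comm]
  exact Real.exp_le_exp.2 hG

/-- `ℓ/2 ≤ X/ℓ^{6A}` from `6A log ℓ ≤ ℓ/2` (`X = e^ℓ`). [folklore] -/
theorem half_log_le_div_rpow {X ℓ A : ℝ} (hX : Real.exp ℓ = X) (hℓ : 0 < ℓ)
    (hG : 6 * A * Real.log ℓ ≤ ℓ / 2) : ℓ / 2 ≤ X / ℓ ^ (6 * A) := by
  rw [div_rpow_log_eq_exp hX hℓ]
  have h1 : ℓ / 2 ≤ ℓ - 6 * A * Real.log ℓ := by linarith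
  have h2 : ℓ - 6 * A * Real.log ℓ ≤ Real.exp (ℓ - 6 * A * Real.log ℓ) := by
    have := Real.add_one_le_exp (ℓ - 6 * A * Real.log ℓ); linarith
  linarith

/-! ### Bridges to the skeleton -/

/-- Proposition 5.1 (corrected fact: `0 ≤ T ≤ 2X`) in the shape `DirichletPieceBound` at a scale
`Y' ≤ 2X` (constant `max C₅ 0`, `L = 1/ℓ^{11A}`). [folklore] -/
theorem pieceBound_of_prop51 {S : ℕ → Prop} [DecidablePred S] {c : ℕ → ℂ} {Y' Xr T₀ C₅ Q ℓ11 : ℝ}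
    (hℓ11 : 0 < ℓ11) (hY' : 0 < Y') (hY'X : Y' ≤ 2 * Xr) (hQ : 0 ≤ Q)
    (h : ∀ T : ℝ, 0 ≤ T → T ≤ 2 * Xr →
      ∫ t in T₀..T, ‖∑ n ∈ (Finset.Icc ⌈Y'⌉₊ ⌊2 * Y'⌋₊).filter S,
          c n * (n : ℂ) ^ (-(1 + (t : ℂ) * Complex.I))‖ ^ 2 ≤ C₅ * (Q * T / Y' + 1) / ℓ11) :
    DirichletPieceBound S c Y' T₀ (max C₅ 0) Q (1 / ℓ11) := by
  intro T hT1 hT2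
  have hT0 : 0 ≤ T := (Real.rpow_nonneg hY'.le _).trans hT1
  have hu : 0 ≤ Q * T / Y' + 1 := by positivity
  have h1 := h T hT0 (hT2.trans hY'X)
  simp only [piecePoly]
  refine h1.trans ?_
  rw [mul_one_div, div_le_div_iff_of_pos_right hℓ11]
  exact mul_le_mul_of_nonneg_right (le_max_left _ _) hu

/-- `conj (λ(n)χ(n)) = λ(n)χ⁻¹(n)`. [folklore] -/
theorem star_liouville_mul_char {q : ℕ} [NeZero q] (χ : DirichletCharacter ℂ q) :
    (fun n : ℕ => star (((liouville n : ℤ) : ℂ) * χ (n : ZMod q))) =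
      fun n : ℕ => ((liouville n : ℤ) : ℂ) * χ⁻¹ (n : ZMod q) := by
  funext n
  rw [star_mul', star_intCast, MulChar.star_apply']

/-- `|λ(n)χ(n)| ≤ 1`. [folklore] -/
theorem norm_liouville_mul_char_le {q : ℕ} (χ : DirichletCharacter ℂ q) (n : ℕ) :
    ‖((liouville n : ℤ) : ℂ) * χ (n : ZMod q)‖ ≤ 1 := by
  rw [norm_mul]
  calc ‖((liouville n : ℤ) : ℂ)‖ * ‖χ (n : ZMod q)‖ ≤ 1 * 1 :=
        mul_le_mul (norm_liouville_le_one n) (χ.norm_le_one _) (norm_nonneg _) zero_le_one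
    _ = 1 := one_mul _


/-- The Lemma-4.8 bound at the integer points of `[Y/2, 3Y]`, in the form consumed by
`norm_longWindow_le`: the hypotheses of Lemma 4.8 (with `(2A, 71A)` for `(A, K)`) are met there
(`q ≤ ℓ^A ≤ (log N)^{2A}`, and the sieving primes lie in `(q, N^{1/log log N})` as
`P₁ = ℓ^{c'A} > ℓ^A ≥ q`, `c' > 1`, and `Q_j ≤ exp(ℓ^{max(2/3, 1-δ/2)})`).
[cite: Lichtman2020, §5, proof of Proposition 3.4, (5.3)] -/
theorem lemma48_at_points {c' A δ C₈ Y : ℝ} {X : ℕ} {H : ℕ → ℕ} {q : ℕ} (χ : DirichletCharacter ℂ q)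
    (hc' : 1 < c') (hA : 0 < A) (hδ : 0 < δ)
    (h8 : ∀ x : ℝ, 3 ≤ x → ∀ q : ℕ, 1 ≤ q → (q : ℝ) ≤ Real.log x ^ (2 * A) →
      ∀ χ : DirichletCharacter ℂ q, ∀ P : Finset ℕ,
        (∀ p ∈ P, p.Prime ∧ (q : ℝ) < p ∧ (p : ℝ) < x ^ (1 / Real.log (Real.log x))) →
        ‖∑ m ∈ (Icc 1 ⌊x⌋₊).filter (fun m => ∀ p ∈ P, ¬ p ∣ m),
            ((liouville m : ℤ) : ℂ) * χ (m : ZMod q)‖ ≤ C₈ * x / Real.log x ^ (71 * A))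
    (hX1 : (1 : ℝ) < X) (hℓ4 : 4 ≤ Real.log X) (hℓx₀ : 4 * 3 + 8 ≤ Real.log X)
    (hHX : (H X : ℝ) ≤ Real.exp (Real.log X ^ (2 / 3 : ℝ)))
    (hGa : Real.log 2 + 6 * A * Real.log (Real.log X) ≤ Real.log X / 2)
    (hGe : A * Real.log (Real.log X) + 1 ≤ Real.log X ^ (2 / 3 : ℝ))
    (hGf : 8 * Real.log (Real.log X) * Real.log X ^ (max (2 / 3 : ℝ) (1 - δ / 2)) < Real.log X)
    (hq : 1 ≤ q) (hqA : (q : ℝ) ≤ Real.log X ^ A)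
    (hY1 : (X : ℝ) / Real.log X ^ (6 * A) ≤ Y) (hY2 : Y ≤ X) (hYℓ : Real.log X / 2 ≤ Y) :
    ∀ N : ℕ, Y / 2 ≤ N → (N : ℝ) ≤ 3 * Y → ∀ P : Finset ℕ,
      P ⊆ IntervalSieve.primesIcc (Real.log X ^ (c' * A)) ((H X : ℝ) / Real.log X ^ (4 * A))
        ∪ IntervalSieve.primesIcc (Real.exp (Real.log X ^ (2 / 3 + δ / 2))) (Real.exp (Real.log X ^ (1 - δ / 2))) →
      ‖∑ m ∈ (Icc 1 N).filter (fun m => ∀ p ∈ P, ¬ p ∣ m),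
          ((liouville m : ℤ) : ℂ) * χ (m : ZMod q)‖ ≤ max C₈ 0 * N / Real.log N ^ (71 * A) := by
  intro N hN1 hN2 P hP
  set ℓ := Real.log X with hℓdef
  have hℓ0 : 0 < ℓ := by linarith
  have hℓ1 : 1 < ℓ := by linarith
  have hX0 : (0 : ℝ) < X := by linarith
  have h6 : 0 < ℓ ^ (6 * A) := Real.rpow_pos_of_pos hℓ0 _
  have hN1' : (X : ℝ) / (2 * Real.log X ^ (6 * A)) ≤ N := by
    have : (X : ℝ) / (2 * Real.log X ^ (6 * A)) = X / Real.log X ^ (6 * A) / 2 := by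
      rw [div_div, mul_comm]
    rw [this]; linarith
  have hN2' : (N : ℝ) ≤ 3 * X := hN2.trans (by linarith)
  obtain ⟨hlo, hhi⟩ := log_point_bounds hX1 (by linarith) hGa hN1' hN2'
  have hN0 : (0 : ℝ) < N := lt_of_lt_of_le (by linarith) hN1
  have hN3 : (3 : ℝ) ≤ N := by linarith
  have hq2 : (q : ℝ) ≤ Real.log N ^ (2 * A) := hqA.trans (rpow_le_rpow_log_point hℓ4 hA.le hlo)
  -- the sieving primes
  set E₀ := max (2 / 3 : ℝ) (1 - δ / 2) with hE₀
  have hexpE : ∀ {u : ℝ}, u ≤ E₀ → Real.exp (ℓ ^ u) ≤ Real.exp (ℓ ^ E₀) := fun hu =>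
    Real.exp_le_exp.2 (Real.rpow_le_rpow_of_exponent_le hℓ1.le hu)
  have hHE : (H X : ℝ) ≤ Real.exp (ℓ ^ E₀) := hHX.trans (hexpE (le_max_left _ _))
  have hqℓ : (q : ℝ) < ℓ ^ (c' * A) :=
    lt_of_le_of_lt hqA ((Real.rpow_lt_rpow_left_iff hℓ1).2 (by nlinarith))
  have hqP₂ : (q : ℝ) < Real.exp (ℓ ^ (2 / 3 + δ / 2)) := by
    refine lt_of_le_of_lt hqA ?_
    rw [Real.rpow_def_of_pos hℓ0, Real.exp_lt_exp]
    have h1 : ℓ ^ (2 / 3 : ℝ) ≤ ℓ ^ (2 / 3 + δ / 2) :=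
      Real.rpow_le_rpow_of_exponent_le hℓ1.le (by linarith)
    nlinarith
  have hPcond : ∀ p ∈ P, p.Prime ∧ (q : ℝ) < p ∧ (p : ℝ) < (N : ℝ) ^ (1 / Real.log (Real.log N)) := by
    intro p hp
    have hp' := hP hp
    rw [Finset.mem_union, IntervalSieve.mem_primesIcc, IntervalSieve.mem_primesIcc] at hp'
    rcases hp' with ⟨hpr, hP1, hQ1⟩ | ⟨hpr, hP2, hQ2⟩
    · refine ⟨hpr, hqℓ.trans_le hP1, lt_rpow_inv_loglog hℓ4 hN0 hlo hhi ?_ hGf⟩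
      have h4 : 1 ≤ ℓ ^ (4 * A) := Real.one_le_rpow hℓ1.le (by positivity)
      have hH0 : (0 : ℝ) ≤ H X := Nat.cast_nonneg _
      exact hQ1.trans ((div_le_self hH0 h4).trans hHE)
    · exact ⟨hpr, hqP₂.trans_le hP2,
        lt_rpow_inv_loglog hℓ4 hN0 hlo hhi (hQ2.trans (hexpE (le_max_right _ _))) hGf⟩
  have key := h8 N hN3 q hq hq2 χ P hPcond
  rw [Nat.floor_natCast] at key
  refine key.trans ?_
  have hK0 : 0 ≤ Real.log N ^ (71 * A) := Real.rpow_nonneg (by linarith) _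
  exact div_le_div_of_nonneg_right (mul_le_mul_of_nonneg_right (le_max_left _ _) hN0.le) hK0

end Lichtman2020

/-! ### Proposition 3.4 from Proposition 5.1 and Lemma 4.8, along `S_c`, `c ≥ 100` -/

-- The assembly below is long but linear (ten filters, two piece bounds, numerics); it needs about
-- twice the default heartbeat budget.
set_option maxHeartbeats 400000 in
open Lichtman2020 ArithmeticFunction in
/-- **Lichtman 2020, Proposition 3.4 from Proposition 5.1 and Lemma 4.8, along the typical sets
`S_c`, `c ≥ 100`** ("Proof of Proposition 3.4 from Proposition 5.1", p. 14): the named facts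
`Lichtman2020_dirichletMeanValueWith` (the corrected Proposition 5.1) and
`Lichtman2020_liouvilleCharacterSifted` (Lemma 4.8) imply the named fact
`Lichtman2020_liouvilleMeanSquareWith` (the corrected Proposition 3.4), Lemma 4.6 (Parseval) and
Lemma 4.1 (mean value theorem) being proved in the tree.  With `ℓ = log X`, `T₀ = ℓ^{22A}`,
`h₂ = Y/T₀³`, `K = 71A`: the long windows are `≤ η = 24C₈Y/(ℓ/2)^K` (`norm_longWindow_le`,
`lemma48_at_points`), the two Proposition-5.1 bounds (for `χ`, `χ⁻¹` at the scale `Y`) feed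
`meanSquare_le_of_pieces_trunc`, and the numerics give the constant
`24·2431²(4004 + 72C₅) + 2(24C₈2^{71A})²`. [cite: Lichtman2020, Proposition 3.4] -/
theorem Lichtman2020_liouvilleMeanSquareWith_of_dirichletMeanValueWith
    (h51 : Lichtman2020_dirichletMeanValueWith) (h48 : Lichtman2020_liouvilleCharacterSifted) :
    Lichtman2020_liouvilleMeanSquareWith := by
  intro c hc A hA δ hδ H hH hHexp
  have hA0 : 0 < A := by linarith
  have hc1 : 1 < c := by linarith
  obtain ⟨C₅, h5⟩ := h51 c hc A hA δ hδ H hH hHexp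
  obtain ⟨C₈, h8⟩ := h48 (2 * A) (71 * A) (by linarith) (by linarith)
  have hC₅'0 : 0 ≤ max C₅ 0 := le_max_right _ _
  have hC₈'0 : 0 ≤ max C₈ 0 := le_max_right _ _
  have hE₀1 : max (2 / 3 : ℝ) (1 - δ / 2) < 1 := max_lt (by norm_num) (by linarith)
  refine ⟨24 * 2431 ^ 2 * (4004 + 72 * max C₅ 0) + 2 * (24 * max C₈ 0 * 2 ^ (71 * A)) ^ 2, ?_⟩
  filter_upwards [h5, hHexp, eventually_rpow_log_le_H hH (15 * A), eventually_cond_a hA0,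
    eventually_cond_b hA0, eventually_cond_d hA0, eventually_cond_e hA0, eventually_cond_f hE₀1,
    tendsto_log_natCast.eventually_ge_atTop (4 * 3 + 8), eventually_ge_atTop 3]
    with X h5X hHX hH15 hGa hGb hGd hGe hGf hℓbig hX3
  intro q hq hqA χ h hh1 hh2 Y hY1 hY2
  -- the scale `ℓ = log X`
  set ℓ := Real.log X with hℓdef
  have hℓ4 : 4 ≤ ℓ := by linarith
  have hℓ1 : 1 ≤ ℓ := by linarith
  have hℓ0 : 0 < ℓ := by linarith
  have hX3' : (3 : ℝ) ≤ X := by exact_mod_cast hX3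
  have hX0 : (0 : ℝ) < X := by linarith
  have hX1 : (1 : ℝ) < X := by linarith
  have hXexp : Real.exp ℓ = X := Real.exp_log hX0
  -- `H`, `h`
  have hHx0 : (0 : ℝ) < H X := lt_of_lt_of_le (Real.rpow_pos_of_pos hℓ0 _) hH15
  have hh2r : (h : ℝ) ≤ H X := by exact_mod_cast hh2
  have hh0 : (0 : ℝ) < h := lt_of_lt_of_le (div_pos hHx0 (Real.rpow_pos_of_pos hℓ0 _)) hh1
  have hh1' : (1 : ℝ) ≤ h := by
    have : 0 < h := by exact_mod_cast hh0
    exact_mod_cast this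
  -- `Y`
  have hGa' : 6 * A * Real.log ℓ ≤ ℓ / 2 := by
    have : (0 : ℝ) ≤ Real.log 2 := Real.log_nonneg (by norm_num); linarith
  have hYℓ : ℓ / 2 ≤ Y := (half_log_le_div_rpow hXexp hℓ0 hGa').trans hY1
  have hY2' : 2 ≤ Y := by linarith
  have hY1' : 1 ≤ Y := by linarith
  have hY0 : 0 < Y := by linarith
  -- `T₀`, `h₂`, `U`
  have hT₀1 : 1 ≤ ℓ ^ (22 * A) := Real.one_le_rpow hℓ1 (by positivity)
  have hhh₂ : (h : ℝ) ≤ Y / (ℓ ^ (22 * A)) ^ 3 := h_le_h₂ hXexp hℓ1 hh2r hHX hY1 hGb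
  have hh₂0 : 0 ≤ Y / (ℓ ^ (22 * A)) ^ 3 := by positivity
  have hh₂Y : Y / (ℓ ^ (22 * A)) ^ 3 ≤ Y := div_le_self hY0.le (one_le_pow₀ hT₀1)
  have hT₀U : ℓ ^ (22 * A) ≤ Y / h := T₀_le_U hXexp hℓ1 hA0.le hh0 hh2r hHX hY1 hGb
  have hU : Y ^ (1 / 2 : ℝ) ≤ Y / h := sqrt_le_U' hXexp hℓ1 hh0 hh2r hHX hY1 hGd
  have hQ0 : (0 : ℝ) ≤ H X / ℓ ^ (4 * A) := by positivity
  have hℓ11 : 0 < ℓ ^ (11 * A) := Real.rpow_pos_of_pos hℓ0 _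
  have hL0 : (0 : ℝ) ≤ 1 / ℓ ^ (11 * A) := by positivity
  have hη0 : 0 ≤ 24 * max C₈ 0 * Y / (ℓ / 2) ^ (71 * A) := by positivity
  -- the long windows ((5.3))
  have h8' := lemma48_at_points χ hc1 hA0 hδ h8 hX1 hℓ4 hℓbig hHX hGa hGe hGf hq hqA hY1 hY2 hYℓ
  have hlogN : ∀ N : ℕ, Y / 2 ≤ N → (N : ℝ) ≤ 3 * Y → ℓ / 2 ≤ Real.log N := by
    intro N hN1 hN2
    have hN1' : (X : ℝ) / (2 * Real.log X ^ (6 * A)) ≤ N := by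
      have : (X : ℝ) / (2 * Real.log X ^ (6 * A)) = X / Real.log X ^ (6 * A) / 2 := by
        rw [div_div, mul_comm]
      rw [this]; linarith
    exact (log_point_bounds hX1 (by linarith) hGa hN1' (hN2.trans (by linarith))).1
  have hS₂ : ∀ x ∈ Set.Icc Y (2 * Y),
      ‖∑ m ∈ (Finset.Icc ⌈x⌉₊ ⌊x + Y / (ℓ ^ (22 * A)) ^ 3⌋₊).filter
        (lichtmanTypicalWith c X A δ (H X)),
        ((liouville m : ℤ) : ℂ) * χ (m : ZMod q)‖ ≤ 24 * max C₈ 0 * Y / (ℓ / 2) ^ (71 * A) :=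
    fun x hx => norm_longWindow_le χ hY2' hh₂0 hh₂Y hx hC₈'0 (by positivity) (by linarith) hlogN h8'
  -- the two Proposition-5.1 bounds at the scale `Y`
  have hY2X : Y ≤ 2 * (X : ℝ) := by linarith
  haveI : NeZero q := ⟨by omega⟩
  have hP₁ : DirichletPieceBound (lichtmanTypicalWith c X A δ (H X))
      (fun n => ((liouville n : ℤ) : ℂ) * χ (n : ZMod q)) Y (ℓ ^ (22 * A)) (max C₅ 0)
      (H X / ℓ ^ (4 * A)) (1 / ℓ ^ (11 * A)) :=
    pieceBound_of_prop51 hℓ11 hY0 hY2X hQ0 fun T hT1 hT2 => h5X q hq hqA χ Y hY1 hY2 T hT1 hT2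
  have hP₃ : DirichletPieceBound (lichtmanTypicalWith c X A δ (H X))
      (fun n => star (((liouville n : ℤ) : ℂ) * χ (n : ZMod q))) Y (ℓ ^ (22 * A)) (max C₅ 0)
      (H X / ℓ ^ (4 * A)) (1 / ℓ ^ (11 * A)) := by
    rw [star_liouville_mul_char χ]
    exact pieceBound_of_prop51 hℓ11 hY0 hY2X hQ0
      fun T hT1 hT2 => h5X q hq hqA χ⁻¹ Y hY1 hY2 T hT1 hT2
  -- the skeleton
  have main := meanSquare_le_of_pieces_trunc (lichtmanTypicalWith c X A δ (H X))
    (c := fun n => ((liouville n : ℤ) : ℂ) * χ (n : ZMod q)) (norm_liouville_mul_char_le χ)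
    hY1' hT₀1 hh1' hhh₂ le_rfl hη0 hC₅'0 hQ0 hL0 hT₀U hU hS₂ hP₁ hP₃
  refine main.trans ?_
  -- numerics
  have hX16 : ℓ ^ (16 * A) ≤ X := by
    refine rpow_log_le_self hXexp hℓ0 ?_
    have h1 : 0 ≤ Real.log ℓ := Real.log_nonneg hℓ1
    have h2 : 0 ≤ ℓ ^ (2 / 3 : ℝ) := Real.rpow_nonneg hℓ0.le _
    nlinarith
  have hn1 := numerics_T₀ hℓ1 hA0.le (ℓ := ℓ)
  have hn2 := numerics_main hℓ1 hA0.le hC₅'0 hHx0 hh1 (A := A)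
  have hn3 := numerics_h hℓ1 hH15 hh1
  have hn4 := numerics_Y hℓ1 hX16 hY1
  rw [numerics_eta hℓ1 hY0]
  have hι : 0 < 1 / ℓ ^ (10 * A) := by positivity
  have hsum : 2000 / (ℓ ^ (22 * A)) ^ 2 + 36 * max C₅ 0 * (H X / ℓ ^ (4 * A) / h + 1) * (1 / ℓ ^ (11 * A))
      + 2000 / h + 4 / Y ≤ (4004 + 72 * max C₅ 0) * (1 / ℓ ^ (10 * A)) := by
    linarith
  have hpre : 0 ≤ 24 * 2431 ^ 2 * (h : ℝ) ^ 2 * Y := by positivity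
  have h1 := mul_le_mul_of_nonneg_left hsum hpre
  have e : (h : ℝ) ^ 2 * Y / ℓ ^ (10 * A) = (h : ℝ) ^ 2 * Y * (1 / ℓ ^ (10 * A)) := by
    rw [mul_one_div]
  rw [e]
  linarith [h1]

end Literature.NumberTheory.Sieve
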